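import Mathlib
import Summits.MatrixMultiplication.MatrixMultiplication.Theorems.SoloBlindFlatWrapperMode
import Summits.MatrixMultiplication.MatrixMultiplication.Theorems.SoloBlindFlatCertThree
import Summits.MatrixMultiplication.MatrixMultiplication.Theorems.SoloBlindFlatCertFourKA
import Summits.MatrixMultiplication.MatrixMultiplication.Theorems.SoloBlindFlatCertFourKB
import Summits.MatrixMultiplication.MatrixMultiplication.Theorems.SoloBlindFlatCertFourKC
import Summits.MatrixMultiplication.MatrixMultiplication.Theorems.SoloBlindFlatCertFourKD

/-!
# Conjecture K♭ at corank at most four, every rank (certified)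

The mode-K flat certificate up to four letters at scale `56` (`m ≤ 3` from `SoloBlindFlatCertThree`,
`m = 4` in seven chunks), hence by `soloBlind_kflat_of_certifiedK`: in a `ZMod 3`-module, for `h`
zero-sum free on `S` with `|S| ≤ dim span h(S) + 4`, CONJECTURE K♭ holds at every target:
`K(τ; S) ≤ 1 + 2^{-ρ} - 2^{ρ-c}` (`ρ` the rank, `c` the size of the core of `τ`).  This refines the
certified Kraft inequality `K ≤ 1` at corank at most four (`soloBlind_kraft_rank_add_four`).
Computational (downstream of `native_decide`).
-/

namespace Summit.MatrixMultiplication.MatrixMultiplication.Theorems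

/-- The seven chunks of the four-letter mode-K certificate. -/
theorem soloBlind_flatCert_four_K : ∀ i < 7, soloBlindFlatCertCanon 4 7 i 56 false = true := by
  intro i hi
  interval_cases i
  exacts [soloBlind_flatCert_four_K_0, soloBlind_flatCert_four_K_1, soloBlind_flatCert_four_K_2,
    soloBlind_flatCert_four_K_3, soloBlind_flatCert_four_K_4, soloBlind_flatCert_four_K_5,
    soloBlind_flatCert_four_K_6]

/-- THE MODE-K FLAT CERTIFICATE UP TO FOUR LETTERS at scale `56`. -/
theorem soloBlind_flatCertifiedK_four : soloBlindFlatCertifiedMode 4 56 false := by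
  intro m hm
  rcases Nat.lt_or_ge m 4 with hlt | hge
  · exact soloBlind_flatCertifiedMode_of soloBlind_flatCertified_three false m (by omega)
  · obtain rfl : m = 4 := le_antisymm hm hge
    exact ⟨7, by norm_num, soloBlind_flatCert_four_K⟩

variable {G : Type*} [AddCommGroup G] [DecidableEq G] [Module (ZMod 3) G] {ι : Type*} [DecidableEq ι]

/-- CONJECTURE K♭ AT CORANK AT MOST FOUR, EVERY RANK: `h` zero-sum free on `S` with
`|S| ≤ dim span h(S) + 4` ⟹ `K(τ; S) ≤ 1 + 2^{-ρ} - 2^{ρ-c}` for every `τ`. -/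
theorem soloBlind_kflat_rank_add_four {h : ι → G} {S : Finset ι}
    (hc : S.card ≤ Module.finrank (ZMod 3) (Submodule.span (ZMod 3) (h '' (↑S : Set ι))) + 4)
    (zsf : ∀ T ⊆ S, T.Nonempty → ∑ i ∈ T, h i ≠ 0) (τ : G) : soloBlindKFlatAt h S τ :=
  soloBlind_kflat_of_certifiedK soloBlind_flatCertifiedK_four (by norm_num) hc zsf τ

end Summit.MatrixMultiplication.MatrixMultiplication.Theorems
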